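import Mathlib
import Summits.Ventures.PercRepro2.BluePinLift
import Summits.Ventures.PercRepro2.StepPattern

/-!
# The (RS) form: the i = 0 row of STEP as a one-clutter, one-red-pin statement, and its monotone route
(seat mine-b, cell pub-perc-repro2; conjectures/MINE-B.md §14, CORRECTION and Addendum 3)

The blue-pin statement (BP) of AsymPins.lean / BluePin.lean is (AS3) on the nested pairs with the FIRST
event bigger.  The i = 0 row of the STEP family — `stepH_zero_of_AS3` needs `AS3 Y (pinFlow j) (pinCarries)`
with `pinFlow j ⊆ pinCarries` — lives in the other regime, first event SMALLER.  Its one-clutter form is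
**(RS)**: for a clutter `H`, pins `O`, split set `Y` and a RED-only pin `q`, the (AS3) inequality for the
pair `(H (O ∪ ·), H (O ∪ q ∪ ·))` on the cube `Y` (cube-level disjoint occurrences, pins shareable):
`rsSlack H O Y q ≥ 0`.

* `AS3_iff_rs` — **`AS3 U A B ↔ (RS)` for the clutter `bpEvent B A q` at `(∅, U, q)`**, for increasing
  `A ⊆ B` and `q ∉ U` (the clutter `min A ∪ {K ∪ q : K ∈ min B ∖ A}`: on `q`-free sets it is `A`, with `q` it
  is `B`, so the pair `(H(·), H(· ∪ q))` IS `(A, B)`);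
* `rs_of_incRS` — the monotone route: if the (RS) slack never decreases when an element joins the split
  set (`IncRS`, the row (INC-RS): exhaustive on every clutter on ≤ 6 elements, MINE-B.md §14 Addendum 3),
  then (RS) holds on every pattern (with `Y = ∅` there is no source);
* `AS3_of_rs_option` — (RS) for every clutter on `Option E` gives (AS3) for every nested pair `A ⊆ B` on
  every cube of `E` (the spare element `none`, via `liftEv`);
* `stepH_zero_of_rs_option`, `stepH_zero_of_incRS_option` — hence **(RS) on the unpinned patterns of
  every clutter on `Option E` — in particular (INC-RS) for every such clutter — implies STEP(0, j+2) on
  every pattern of every finite multigraph with edge type `E`**: the i = 0 row of the strand inequalities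
  of ASSIGNMENTS v12.05 is one monotone statement away.
-/

open Finset

namespace Summit.Ventures.PercRepro2

namespace StepZero

open ReimerCube

variable {E : Type*} [DecidableEq E]

open Classical

/-! ## The (RS) slack -/

/-- the (AS3) slack of the pair `(H (O ∪ ·), H (O ∪ q ∪ ·))` on the cube `Y`:
`#{γ ⊆ Y : H (O ∪ γ) ∧ H (O ∪ q ∪ ρ) ∧ ¬ (H_q □ H_q at ρ)} − #{γ ⊆ Y : H □ H_q at γ ∧ ¬ H (O ∪ q ∪ ρ)}`,
`ρ = Y \ γ`, `H_q = H (O ∪ q ∪ ·)`, `□` the cube-level disjoint occurrence -/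
noncomputable def rsSlack (H : Finset E → Prop) (O Y : Finset E) (q : E) : ℤ :=
  ((Y.powerset.filter (fun γ => H (O ∪ γ) ∧ H (insert q O ∪ (Y \ γ)) ∧
      ¬ DOcc (fun X => H (insert q O ∪ X)) (fun X => H (insert q O ∪ X)) (Y \ γ))).card : ℤ)
    - (Y.powerset.filter (fun γ => DOcc (fun X => H (O ∪ X)) (fun X => H (insert q O ∪ X)) γ ∧
      ¬ H (insert q O ∪ (Y \ γ)))).card

/-- **(RS)**: the (AS3) inequality for `(H (O ∪ ·), H (O ∪ q ∪ ·))` on every pattern — `q` a red-only pin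
that blue may use once and that the two red witnesses may share -/
def RS (H : Finset E → Prop) : Prop :=
  ∀ (O Y : Finset E) (q : E), q ∉ O → q ∉ Y → 0 ≤ rsSlack H O Y q

/-- (RS) on the unpinned patterns `(∅, Y)` only — all that the spare-element argument uses -/
def RS₀ (H : Finset E → Prop) : Prop :=
  ∀ (Y : Finset E) (q : E), q ∉ Y → 0 ≤ rsSlack H ∅ Y q

/-- **(INC-RS)**: the (RS) slack never decreases when an element joins the split set -/
def IncRS (H : Finset E → Prop) : Prop :=
  ∀ (O Y : Finset E) (q y : E), q ∉ O → q ∉ Y → y ∉ O → y ∉ Y → y ≠ q →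
    rsSlack H O Y q ≤ rsSlack H O (insert y Y) q

/-- the (RS) slack is the (AS3) statement for the pinned pair -/
theorem AS3_iff_rsSlack_nonneg (H : Finset E → Prop) (O Y : Finset E) (q : E) :
    AS3 Y (fun X => H (O ∪ X)) (fun X => H (insert q O ∪ X)) ↔ 0 ≤ rsSlack H O Y q := by
  unfold AS3 rsSlack
  beta_reduce
  omega

/-- with an empty split set there is no source -/
lemma rsSlack_empty_nonneg (H : Finset E → Prop) (O : Finset E) (q : E) :
    0 ≤ rsSlack H O ∅ q := by
  unfold rsSlack
  have h : (∅ : Finset E).powerset.filter (fun γ => DOcc (fun X => H (O ∪ X))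
      (fun X => H (insert q O ∪ X)) γ ∧ ¬ H (insert q O ∪ (∅ \ γ))) = ∅ := by
    rw [Finset.filter_eq_empty_iff]
    intro γ hγ
    rw [Finset.mem_powerset, Finset.subset_empty] at hγ
    subst hγ
    rintro ⟨hD, hn⟩
    have := (A_and_B_of_dOcc hD).2
    simp only [Finset.union_empty] at this
    simp only [Finset.sdiff_empty, Finset.union_empty] at hn
    exact hn this
  rw [h, Finset.card_empty]
  simp

/-- **(INC-RS) implies (RS) on every pattern with disjoint pins and split set**, by induction on the
split set. -/
theorem rs_of_incRS {H : Finset E → Prop} (h : IncRS H) (O Y : Finset E) (hOY : Disjoint O Y) (q : E)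
    (hqO : q ∉ O) (hqY : q ∉ Y) : 0 ≤ rsSlack H O Y q := by
  induction Y using Finset.induction_on with
  | empty => exact rsSlack_empty_nonneg H O q
  | insert y Y hy ih =>
    have hyO : y ∉ O := fun h' => Finset.disjoint_left.mp hOY h' (Finset.mem_insert_self y Y)
    have hd' : Disjoint O Y := Finset.disjoint_of_subset_right (Finset.subset_insert y Y) hOY
    have hqY' : q ∉ Y := fun h' => hqY (Finset.mem_insert_of_mem h')
    have hyq : y ≠ q := fun h' => hqY (h' ▸ Finset.mem_insert_self y Y)
    exact le_trans (ih hd' hqY') (h O Y q y hqO hqY' hyO hy hyq)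

/-- (INC-RS) implies (RS) on the unpinned patterns -/
theorem rs₀_of_incRS {H : Finset E → Prop} (h : IncRS H) : RS₀ H :=
  fun Y q hqY => rs_of_incRS h ∅ Y (Finset.disjoint_empty_left Y) q (Finset.notMem_empty q) hqY

/-! ## (RS) is (AS3) for the nested pairs with the first event smaller -/

/-- up-witnesses of the `q`-closed section of `bpEvent B A q` are up-witnesses of `A` -/
lemma bpEvent_witness_closed_iff {A B : Finset E → Prop} (hA : Incr A) (q : E) {K : Finset E}
    (hq : q ∉ K) :
    (∀ T, K ⊆ T → bpEvent B A q (∅ ∪ T)) ↔ (∀ T, K ⊆ T → A T) := by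
  simp only [Finset.empty_union]
  exact bpEvent_witness_iff hA q hq

/-- up-witnesses of the `q`-open section of `bpEvent B A q` are up-witnesses of `B` (for `A ⊆ B`) -/
lemma bpEvent_witness_open_iff {A B : Finset E → Prop} (hB : Incr B) (hAB : ∀ X, A X → B X) (q : E)
    {L : Finset E} (hq : q ∉ L) :
    (∀ T, L ⊆ T → bpEvent B A q (insert q ∅ ∪ T)) ↔ (∀ T, L ⊆ T → B T) := by
  simp only [Finset.insert_union, Finset.empty_union]
  have e : ∀ T : Finset E, bpEvent B A q (insert q T) ↔ B (T.erase q) := by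
    intro T
    unfold bpEvent
    rw [Finset.erase_insert_eq_erase]
    constructor
    · rintro (h | ⟨-, h⟩)
      · exact hAB _ h
      · exact h
    · exact fun h => Or.inr ⟨Finset.mem_insert_self q T, h⟩
  simp only [e]
  constructor
  · intro h T hLT
    exact hB (Finset.erase_subset q T) (h T hLT)
  · intro h T hLT
    exact h (T.erase q) (fun x hx => Finset.mem_erase.mpr ⟨fun hxq => hq (hxq ▸ hx), hLT hx⟩)

/-- disjoint occurrences of the two sections of `bpEvent B A q` on a `q`-free set are disjoint
occurrences of `(A, B)` -/
lemma dOcc_bpEvent_sections_iff {A B : Finset E → Prop} (hA : Incr A) (hB : Incr B)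
    (hAB : ∀ X, A X → B X) (q : E) {γ : Finset E} (hqγ : q ∉ γ) :
    DOcc (fun X => bpEvent B A q (∅ ∪ X)) (fun X => bpEvent B A q (insert q ∅ ∪ X)) γ ↔ DOcc A B γ := by
  constructor
  · rintro ⟨K, L, hK, hL, hKL, hEK, hEL⟩
    have hqK : q ∉ K := fun h => hqγ (hK h)
    have hqL : q ∉ L := fun h => hqγ (hL h)
    exact ⟨K, L, hK, hL, hKL, (bpEvent_witness_closed_iff hA q hqK).mp hEK,
      (bpEvent_witness_open_iff hB hAB q hqL).mp hEL⟩
  · rintro ⟨K, L, hK, hL, hKL, hAK, hBL⟩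
    have hqK : q ∉ K := fun h => hqγ (hK h)
    have hqL : q ∉ L := fun h => hqγ (hL h)
    exact ⟨K, L, hK, hL, hKL, (bpEvent_witness_closed_iff hA q hqK).mpr hAK,
      (bpEvent_witness_open_iff hB hAB q hqL).mpr hBL⟩

/-- likewise for two witnesses of the `q`-open section -/
lemma dOcc_bpEvent_open_iff {A B : Finset E → Prop} (hB : Incr B) (hAB : ∀ X, A X → B X) (q : E)
    {ρ : Finset E} (hqρ : q ∉ ρ) :
    DOcc (fun X => bpEvent B A q (insert q ∅ ∪ X)) (fun X => bpEvent B A q (insert q ∅ ∪ X)) ρ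
      ↔ DOcc B B ρ := by
  constructor
  · rintro ⟨K, L, hK, hL, hKL, hEK, hEL⟩
    have hqK : q ∉ K := fun h => hqρ (hK h)
    have hqL : q ∉ L := fun h => hqρ (hL h)
    exact ⟨K, L, hK, hL, hKL, (bpEvent_witness_open_iff hB hAB q hqK).mp hEK,
      (bpEvent_witness_open_iff hB hAB q hqL).mp hEL⟩
  · rintro ⟨K, L, hK, hL, hKL, hBK, hBL⟩
    have hqK : q ∉ K := fun h => hqρ (hK h)
    have hqL : q ∉ L := fun h => hqρ (hL h)
    exact ⟨K, L, hK, hL, hKL, (bpEvent_witness_open_iff hB hAB q hqK).mpr hBK,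
      (bpEvent_witness_open_iff hB hAB q hqL).mpr hBL⟩

/-- **`AS3 U A B ↔ (RS)` for the clutter `bpEvent B A q` at `(∅, U, q)`** (increasing `A ⊆ B`, `q ∉ U`). -/
theorem AS3_iff_rs {A B : Finset E → Prop} (hA : Incr A) (hB : Incr B) (hAB : ∀ X, A X → B X)
    (U : Finset E) (q : E) (hqU : q ∉ U) : AS3 U A B ↔ 0 ≤ rsSlack (bpEvent B A q) ∅ U q := by
  rw [← AS3_iff_rsSlack_nonneg]
  unfold AS3
  have eA : ∀ X : Finset E, q ∉ X → (bpEvent B A q (∅ ∪ X) ↔ A X) := fun X hX => by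
    rw [Finset.empty_union]; exact bpEvent_of_not_mem q hX
  have eB : ∀ X : Finset E, q ∉ X → (bpEvent B A q (insert q ∅ ∪ X) ↔ B X) := fun X hX => by
    rw [Finset.insert_union, Finset.empty_union]; exact bpEvent_insert_iff hAB q hX
  have e1 : U.powerset.filter (fun γ => DOcc A B γ ∧ ¬ B (U \ γ))
      = U.powerset.filter (fun γ => DOcc (fun X => bpEvent B A q (∅ ∪ X))
          (fun X => bpEvent B A q (insert q ∅ ∪ X)) γ ∧ ¬ bpEvent B A q (insert q ∅ ∪ (U \ γ))) := by
    apply Finset.filter_congr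
    intro γ hγ
    rw [Finset.mem_powerset] at hγ
    have hqγ : q ∉ γ := fun h => hqU (hγ h)
    have hqρ : q ∉ U \ γ := fun h => hqU (Finset.mem_sdiff.mp h).1
    rw [dOcc_bpEvent_sections_iff hA hB hAB q hqγ, eB _ hqρ]
  have e2 : U.powerset.filter (fun γ => A γ ∧ B (U \ γ) ∧ ¬ DOcc B B (U \ γ))
      = U.powerset.filter (fun γ => bpEvent B A q (∅ ∪ γ) ∧ bpEvent B A q (insert q ∅ ∪ (U \ γ)) ∧
          ¬ DOcc (fun X => bpEvent B A q (insert q ∅ ∪ X))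
            (fun X => bpEvent B A q (insert q ∅ ∪ X)) (U \ γ)) := by
    apply Finset.filter_congr
    intro γ hγ
    rw [Finset.mem_powerset] at hγ
    have hqγ : q ∉ γ := fun h => hqU (hγ h)
    have hqρ : q ∉ U \ γ := fun h => hqU (Finset.mem_sdiff.mp h).1
    rw [eA _ hqγ, eB _ hqρ, dOcc_bpEvent_open_iff hB hAB q hqρ]
  rw [e1, e2]

/-- **(RS) on the unpinned patterns of every clutter on `Option E` gives (AS3) for every nested pair
`A ⊆ B` on every cube of `E`** (spare element `none`). -/
theorem AS3_of_rs_option (h : ∀ H : Finset (Option E) → Prop, Incr H → RS₀ H)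
    {A B : Finset E → Prop} (hA : Incr A) (hB : Incr B) (hAB : ∀ X, A X → B X) (U : Finset E) :
    AS3 U A B := by
  rw [← AS3_liftEv_iff hA hB U]
  have hnone : (none : Option E) ∉ U.map emb := by
    intro hmem
    obtain ⟨a, -, ha⟩ := Finset.mem_map.mp hmem
    exact Option.some_ne_none a ha
  rw [AS3_iff_rs (incr_liftEv A) (incr_liftEv B) (fun X ⟨K, hK, hAK⟩ => ⟨K, hK, hAB K hAK⟩)
    (U.map emb) none hnone]
  exact h _ (incr_bpEvent (incr_liftEv B) (incr_liftEv A) none) (U.map emb) none hnone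

/-! ## The graph corollary -/

variable {V : Type*}

/-- `j ≥ 1` pairwise edge-disjoint pinned `s–t` paths give the pinned connection event -/
lemma pinCarries_of_pinFlow (ends : E → Sym2 V) (s t : V) (O : Finset E) (j : ℕ) (X : Finset E)
    (h : pinFlow ends s t O (j + 1) X) : pinCarries ends s t O X := by
  unfold pinFlow at h
  unfold pinCarries
  exact (kDisj_one_iff (incr_carries ends s t) (O ∪ X)).mp
    (pinK_of_le (fun T => Carries ends T s t) O (Nat.succ_le_succ (Nat.zero_le j)) h)

/-- **(RS) for every clutter on `Option E` implies STEP(0, j+2) on every pattern of every finite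
multigraph with edge type `E`**: `#{γ ⊆ Y : F_R = 0 ∧ F_B ≥ j+2} ≤ #{γ ⊆ Y : F_R = 1 ∧ F_B ≥ j+1}`. -/
theorem stepH_zero_of_rs_option (h : ∀ H : Finset (Option E) → Prop, Incr H → RS₀ H)
    (ends : E → Sym2 V) (s t : V) (O Y : Finset E) (j : ℕ) :
    stepH ends s t O Y 0 (j + 2) ≤ stepH ends s t O Y 1 (j + 1) := by
  apply stepH_zero_of_AS3
  exact AS3_of_rs_option h (incr_pinFlow ends s t O (j + 1)) (incr_pinCarries ends s t O)
    (pinCarries_of_pinFlow ends s t O j) Y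

/-- **(INC-RS) for every clutter on `Option E` implies STEP(0, j+2) on every pattern of every finite
multigraph with edge type `E`** — the monotone route to the i = 0 row of the strand inequalities. -/
theorem stepH_zero_of_incRS_option (h : ∀ H : Finset (Option E) → Prop, Incr H → IncRS H)
    (ends : E → Sym2 V) (s t : V) (O Y : Finset E) (j : ℕ) :
    stepH ends s t O Y 0 (j + 2) ≤ stepH ends s t O Y 1 (j + 1) :=
  stepH_zero_of_rs_option (fun H hH => rs₀_of_incRS (h H hH)) ends s t O Y j

end StepZero

end Summit.Ventures.PercRepro2
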